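import Literature.AlgebraicGeometry.Kawanoue2007.WeakOrderMuTilde
import Literature.AlgebraicGeometry.Kawanoue2007.IdealisticFiltrationSaturation
import Literature.AlgebraicGeometry.Kawanoue2007.IdealisticFiltrationLocalization
import Literature.AlgebraicGeometry.KawanoueMatsuki2010.MuTildeIndependence
import Literature.AlgebraicGeometry.KawanoueMatsuki2010.CenterNonsingularityPrinciple
import Mathlib.RingTheory.Spectrum.Maximal.Topology
import Mathlib.RingTheory.Smooth.Basic
import Mathlib.RingTheory.KrullDimension.Basic
import Mathlib.FieldTheory.IsAlgClosed.Basic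
import Mathlib.Algebra.CharP.Defs
import Mathlib.Order.PiLex
import Mathlib.Data.Prod.Lex
import HarnessLib

/-!
# Kawanoue–Matsuki 2010 (IFP Part II): the invariants `σ(P)`, `μ̃(P)` at a closed point — independence of `μ̃` (Prop. 3.1.2.1), upper semicontinuity of `(σ, μ̃)` (Prop. 3.3.1.1), nonsingularity principle with 𝔇-saturation only (Thm. A.1.1.1 (1)) — NAMED FACTS

H. Kawanoue, K. Matsuki, *Toward resolution of singularities over a field of positive characteristic (the Idealistic
Filtration Program). Part II. Basic invariants associated to the idealistic filtration and their properties*, Publ.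
RIMS **46** (2010) 359–422 (= arXiv:math/0612008) [KawanoueMatsuki2010] (refereed). Read on the held arXiv text
(`lit read paper:arxiv-math-0612008`): global setting chunk p0004 L7 / p0012 L13–L15 / p0041 L19–L25, Def. 1.1.1.1
(`σ(P)`) chunk p0013 L1–L9, Def. 1.2.1.1 (upper semicontinuity) chunk p0015 L43–L45, Cor. 1.2.1.3 (lexicographic
order on `∏ ℤ_{≥0}`) chunk p0016 L15, §3.1.1 + Def. 3.1.1.1 (`μ̃(P) = μ_ℋ(𝕀_P)`) chunk p0041 L25 – p0042 L9,
**Prop. 3.1.2.1** chunk p0043 L1–L5, **Prop. 3.3.1.1** chunk p0049 L35–L43, **Thm. A.1.1.1** chunk p0056 L11–L25 with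
Rem. A.1.1.2 and the proof's Step 1 chunk p0057 L13–L17. Campaign `res-hironaka` (D-0089), rung LIT-6 (the Idealistic
Filtration Program as a refereed COMPARISON programme); typed because the director's critic-side batch ORDER
(2026-08-27T14:38:23Z, paper (6)) asks for «the IFP invariant … each component typed; what they prove», and the RES-C
requirement rows of the F10 «IFP-type» family cite exactly these results: (i) «u.s.c. only as the LEX pair (σ, μ̃)
[II Prop 3.3.1.1]», (ii) «LGS-intrinsic [II Prop 3.1.2.1]», (iv) «nonsingularity principle [I Thm 4.2.1.1 / II Thm
A.1.1.1]». SETTLED-LITERATURE file: the pointwise invariants as two small REAL definitions over the tree's carriers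
(`sigmaAt`, `muTildeAt`, on the localization `𝕀_P = 𝕀.atPrime P` of `IdealisticFiltrationLocalization.lean`) and
THREE named facts `def … : Prop` with `[cite]`; statements only (users take `(h : KawanoueMatsuki2010_prop_3_1_2_1)`
etc.). Part I's Thm. 4.2.1.1 (the 𝔅-saturated nonsingularity principle, local form) is the sibling file
`Kawanoue2007/NonsingularityPrinciple.lean`. Nothing of Hironaka's 2017 manuscript is referred to or asserted.

## Update (res-lit-2 g20, 2026-08-27): F-93 DISCHARGED

`KawanoueMatsuki2010_prop_3_1_2_1_holds : KawanoueMatsuki2010_prop_3_1_2_1` is PROVED below (section `DischargeF93`),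
two lines from `MuTildeIndependence.lean` (`muTilde_atPrime_eq_of_isLGS`: the printed proof of Prop. 3.1.2.1 —
lifting the leading terms of one LGS into the ideal of the other, replacing one element at a time, Part I Lemma 4.1.2.3
and the Coefficient Lemma 4.1.4.1, now tree theorems `Kawanoue2007/SupportingLemmas.lean`, `CoefficientLemma.lean`).
`KawanoueMatsuki2010_prop_3_3_1_1` and `KawanoueMatsuki2010_thm_A_1_1_1_part1` remain named facts.

## The printed statements and how they are typed (faithfulness notes)

* **Setting of Part II** (p0004 L7, p0012 L13–L15, p0041 L19–L25): «`R` represents the coordinate ring of an affine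
  open subset Spec `R` of a nonsingular variety `W` of `dim W = d` over an algebraically closed field `k` of positive
  characteristic `char(k) = p` or of characteristic zero `char(k) = 0`, where in the latter case we formally set
  `p = ∞` … Let `𝕀` be an idealistic filtration over `R`. We assume that `𝕀` is 𝔇-saturated. … the localization `𝕀_P`
  is also 𝔇-saturated for any closed point `P ∈ Spec R`». TYPED: `k` algebraically closed with `ExpChar k p` (`p`
  prime = the characteristic, or `p = 1` = the tree's rendering of «`p = ∞`», all levels `p^e = 1`, see
  `Kawanoue2007/LeadingGeneratorSystem.lean`); `A` (= `R` of the source) a smooth finitely generated `k`-algebra which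
  is a domain; `𝕀 : IdealisticFiltration A` with `IsDSaturated k 𝕀`; closed points = maximal ideals `𝔫`
  (`MaximalSpectrum A` with its Zariski topology for Prop. 3.3.1.1); `𝕀_P = 𝕀.atPrime 𝔫` over `R_P = A_𝔫`
  (Kawanoue 2007 Def. 2.4.1.1 (1)); `d = dim W` enters as `ringKrullDim A = d`.
* **Def. 1.1.1.1** «`σ(P) = (d − l^{pure}_{p^e}(P))_{e ∈ ℤ_{≥0}}`, `l^{pure}_{p^e}(P) = dim_k L(𝕀_P)^{pure}_{p^e}`» =
  `sigmaAt p d 𝕀 𝔫 := Kawanoue2007.sigma p d (𝕀.atPrime 𝔫)` (Part I Def. 3.2.1.1 on the localization).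
  **Def. 3.1.1.1** «Take a leading generator system `ℍ = {(h_l, p^{e_l})}` … for `𝕀_P` … `μ̃(P) = μ_ℋ(𝕀_P)`» =
  `muTildeAt 𝕀 𝔫 h := Kawanoue2007.muTilde (𝕀.atPrime 𝔫) h` for a family `h` of elements of `A_𝔫` (the elements of
  an LGS; the definition «should [be shown] independent of the choice of `ℋ`», which is Prop. 3.1.2.1 — typed as a
  fact below, NOT assumed: every statement carries the LGS it reads `μ̃` on).
* **Prop. 3.1.2.1** (p0043 L3–L5): «Let the setting be as described in 3.1.1. Then `μ_ℋ(𝕀_P)` is independent of the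
  choice of `ℋ`, i.e., independent of the choice of a leading generator system `ℍ` for `𝕀_P`» = for two finite LGS's
  `(h, e)`, `(h', e')` of `𝕀_P` (`IsLGS p (𝕀.atPrime 𝔫) …`, Part I Def. 3.1.3.1), `muTildeAt 𝕀 𝔫 h = muTildeAt 𝕀 𝔫 h'`.
* **Prop. 3.3.1.1** (p0049 L35–L43): «The invariant `(σ, μ̃) : X = 𝔪-Spec R → (∏_{e ∈ ℤ_{≥0}} ℤ_{≥0}) × (ℝ_{≥0} ∪ {∞})`
  is upper semi-continuous with respect to the lexicographical order … That is to say, for any `(α, β)`, the locus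
  `X_{≥(α,β)}` is closed (cf. Definition 1.2.1.1)»; Def. 1.2.1.1: «`f` is upper semi-continuous if the set
  `X_{≥t} := {x ∈ X ; f(x) ≥ t}` is closed for any `t ∈ T`»; the first factor «is totally ordered with respect to the
  lexicographical order» (Cor. 1.2.1.3). TYPED: target `Lex (Lex (ℕ → ℤ) × ℝ≥0∞)` (Mathlib's lexicographic orders
  `Pi.Lex` on sequences and `Prod.Lex` on the pair; values `σ(e) ∈ ℤ`, `≥ 0` in print), and since `μ̃(Q)` is read on an
  LGS at each `Q`, the statement quantifies over a SECTION `Q ↦ (h_Q, e_Q)` of finite LGS's (one for each closed point;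
  by Prop. 3.1.2.1 the function does not depend on the section; a section exists by Part I Prop. 3.1.3.2, not assumed
  here — with no section the statement is vacuous): for every `t`, `{Q ; t ≤ (σ(Q), μ̃(Q))}` is closed in
  `MaximalSpectrum A`. The «Assume further … r.f.g. type … extend the domain to Spec R» half is NOT typed.
* **Thm. A.1.1.1 (1)** (p0056 L11–L17): «Let `𝕀` be an idealistic filtration over `R`. Let `P ∈ Spec R ⊂ W` be a
  closed point. (1) Assume that `𝕀` is 𝔇-saturated and that `μ̃(P) = ∞`. Then there exists a regular system of
  parameters `(x_1, …, x_N, y_{N+1}, …, y_d)` at `P` such that `ℍ = {(x_l^{p^{e_l}}, p^{e_l})}_{l=1}^N`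
  `(e_1 ≤ ⋯ ≤ e_N)` is an LGS of `𝕀_P`, `𝕀_P = G_{R_P}(ℍ)`». TYPED: the hypothesis `μ̃(P) = ∞` is read on a given
  finite LGS `(h, e)` of `𝕀_P` (`muTildeAt 𝕀 𝔫 h = ⊤`; by Prop. 3.1.2.1 this is `μ̃(P) = ∞`); conclusion: a regular
  system of parameters `x : Fin d → A_𝔫` (the tree's unbundled convention of `Resolution/RegularSystemOfParameters.lean`:
  `Ideal.span (range x) = 𝔪` and `𝔪.spanFinrank = d`), `N ≤ d`, exponents `e' : Fin N → ℕ` monotone, with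
  `IsLGS p 𝕀_P (l ↦ x_l^{p^{e'_l}}) e'` and `𝕀_P = G({(x_l^{p^{e'_l}}, p^{e'_l})})`. Part (2) (the affine
  neighbourhood `U_P = Spec R_f`, `Supp(𝕀) ∩ U_P = V(x_1, …, x_N)` nonsingular, `(σ(Q), μ̃(Q)) = (σ(P), ∞)` on it) is
  NOT typed (`-- TODO(general form)`); Rem. A.1.1.2 (3): with ℜ-saturation all `e_l = 0`, = Part I Thm. 4.2.1.1
  (sibling file).

## References

* H. Kawanoue, K. Matsuki, Publ. RIMS 46 (2010) 359–422 = arXiv:math/0612008: Def. 1.1.1.1, Def. 1.2.1.1, Cor.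
  1.2.1.3, §3.1.1 / Def. 3.1.1.1, Prop. 3.1.2.1, Prop. 3.3.1.1, Thm. A.1.1.1, Rem. A.1.1.2. [KawanoueMatsuki2010]
* H. Kawanoue, Publ. RIMS 43 (2007) 819–909 = arXiv:math/0607009: Def. 2.4.1.1 (1) (`𝕀_P`), Def. 3.1.3.1 (LGS),
  Def. 3.2.1.1 (`σ`), Def. 3.2.2.1 (`μ̃`), Prop. 3.1.3.2 (existence of an LGS — cited for scope, not assumed).
  [Kawanoue2007]
* H. Matsumura, *Commutative Ring Theory*, §14 p. 105 (regular system of parameters). [Matsumura1987]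
-/

noncomputable section

namespace Literature.AlgebraicGeometry.KawanoueMatsuki2010

open Literature.AlgebraicGeometry.Kawanoue2007
open IsLocalRing
open scoped ENNReal

universe u

/-! ## Def. 1.1.1.1 / Def. 3.1.1.1: the invariants at a closed point, read on the localization `𝕀_P` -/

section Pointwise

variable {A : Type*} [CommRing A]

/-- **`σ(P)`** [KM 2010, Def. 1.1.1.1 p0013 L3–L9: «`σ(P) = (d − l^{pure}_{p^e}(P))_{e ∈ ℤ_{≥0}}` where `d = dim W`,
`l^{pure}_{p^e}(P) = dim_k L(𝕀_P)^{pure}_{p^e}`»]: Part I's `σ` (`Kawanoue2007.sigma`, Def. 3.2.1.1) of the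
localization `𝕀_P = 𝕀.atPrime P` at the prime `P` (a closed point in print; `d` a parameter, `= dim W` in print).
[cite: KawanoueMatsuki2010, Def. 1.1.1.1] -/
def sigmaAt (p d : ℕ) (𝕀 : IdealisticFiltration A) (P : Ideal A) [P.IsPrime] : ℕ → ℤ :=
  sigma p d (𝕀.atPrime P)

/-- Unfolding `σ(P) = σ(𝕀_P)`. [cite: KawanoueMatsuki2010, Def. 1.1.1.1] -/
theorem sigmaAt_eq (p d : ℕ) (𝕀 : IdealisticFiltration A) (P : Ideal A) [P.IsPrime] :
    sigmaAt p d 𝕀 P = sigma p d (𝕀.atPrime P) := rfl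

/-- **`μ̃(P) = μ_ℋ(𝕀_P)`** [KM 2010, §3.1.1 / Def. 3.1.1.1 p0041 L25 – p0042 L9: «Take a leading generator system
`ℍ = {(h_l, p^{e_l})}_{l=1,…,N}` … for the 𝔇-saturated idealistic filtration `𝕀_P`. Let `ℋ = {h_l}` … the invariant
`μ̃` at `P` … is defined by the formula `μ̃(P) = μ_ℋ(𝕀_P)`»]: Part I's `μ_ℋ` (`Kawanoue2007.muTilde`, Def. 3.2.2.1) of
the localization `𝕀_P`, READ ON a family `h` of elements of `R_P` (the `h_l` of an LGS). Its independence of the LGS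
is Prop. 3.1.2.1 (`KawanoueMatsuki2010_prop_3_1_2_1` below), not built into the definition.
[cite: KawanoueMatsuki2010, Def. 3.1.1.1] -/
def muTildeAt (𝕀 : IdealisticFiltration A) (P : Ideal A) [P.IsPrime] {ι : Type*}
    (h : ι → Localization.AtPrime P) : ℝ≥0∞ :=
  muTilde (𝕀.atPrime P) h

/-- Unfolding `μ̃(P) = μ_ℋ(𝕀_P)`. [cite: KawanoueMatsuki2010, Def. 3.1.1.1] -/
theorem muTildeAt_eq (𝕀 : IdealisticFiltration A) (P : Ideal A) [P.IsPrime] {ι : Type*}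
    (h : ι → Localization.AtPrime P) : muTildeAt 𝕀 P h = muTilde (𝕀.atPrime P) h := rfl

end Pointwise

/-! ## Prop. 3.1.2.1: `μ̃(P)` is independent of the leading generator system -/

/-- NAMED FACT — **Kawanoue–Matsuki 2010, Proposition 3.1.2.1** [chunk p0043 L3–L5]: «Let the setting be as described
in 3.1.1. Then `μ_ℋ(𝕀_P)` is independent of the choice of `ℋ`, i.e., independent of the choice of a leading generator
system `ℍ` for `𝕀_P`.» Setting 3.1.1 (p0041 L19–L27): `R` the coordinate ring of an affine open subset of a
nonsingular variety `W` over an algebraically closed field `k` (`char k = p > 0`, or `0` with `p = ∞`), `𝕀` a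
𝔇-saturated idealistic filtration over `R`, `P ∈ Spec R` a closed point, `ℍ = {(h_l, p^{e_l})}_{l=1,…,N}` a leading
generator system of `𝕀_P`. Vendored: for `k` algebraically closed with `ExpChar k p`, `A` a smooth finitely generated
`k`-domain, `𝕀 : IdealisticFiltration A` 𝔇-saturated over `k`, `𝔫 ⊂ A` maximal, and two finite leading generator
systems `(h, e)`, `(h', e')` of `𝕀_𝔫 = 𝕀.atPrime 𝔫` (Part I Def. 3.1.3.1, `IsLGS p`): `μ_ℋ(𝕀_𝔫) = μ_{ℋ'}(𝕀_𝔫)`.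
DISCHARGED in this file: `KawanoueMatsuki2010_prop_3_1_2_1_holds` (via `MuTildeIndependence.lean`); users taking
`(h : KawanoueMatsuki2010_prop_3_1_2_1)` are fed `_holds`.
[cite: KawanoueMatsuki2010, Prop. 3.1.2.1 with §3.1.1] -/
def KawanoueMatsuki2010_prop_3_1_2_1 : Prop :=
  ∀ (p : ℕ) (k : Type u) [Field k] [IsAlgClosed k] [ExpChar k p]
    (A : Type u) [CommRing A] [IsDomain A] [Algebra k A] [Algebra.FiniteType k A] [Algebra.Smooth k A]
    (𝕀 : IdealisticFiltration A), IdealisticFiltration.IsDSaturated k 𝕀 →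
    ∀ (𝔫 : Ideal A) [𝔫.IsMaximal] {ι ι' : Type} [Finite ι] [Finite ι']
      (h : ι → Localization.AtPrime 𝔫) (e : ι → ℕ) (h' : ι' → Localization.AtPrime 𝔫) (e' : ι' → ℕ),
      IsLGS p (𝕀.atPrime 𝔫) h e → IsLGS p (𝕀.atPrime 𝔫) h' e' →
        muTildeAt 𝕀 𝔫 h = muTildeAt 𝕀 𝔫 h'

/-! ## Prop. 3.3.1.1: upper semicontinuity of `(σ, μ̃)` for the lexicographic order -/

/-- The value `(σ(Q), μ̃(Q))` in the lexicographically ordered target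
`(∏_{e ∈ ℤ_{≥0}} ℤ) ×_{lex} [0, ∞]` (print: `(∏ ℤ_{≥0}) × (ℝ_{≥0} ∪ {∞})` «with respect to the lexicographical order»,
the first factor itself «totally ordered with respect to the lexicographical order», Cor. 1.2.1.3), with `μ̃(Q)` read
on the family `h`. [cite: KawanoueMatsuki2010, Prop. 3.3.1.1 and Cor. 1.2.1.3] -/
def sigmaMuTildeAt {A : Type*} [CommRing A] (p d : ℕ) (𝕀 : IdealisticFiltration A) (P : Ideal A) [P.IsPrime]
    {ι : Type*} (h : ι → Localization.AtPrime P) : Lex (Lex (ℕ → ℤ) × ℝ≥0∞) :=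
  toLex (toLex (sigmaAt p d 𝕀 P), muTildeAt 𝕀 P h)

/-- NAMED FACT — **Kawanoue–Matsuki 2010, Proposition 3.3.1.1 (upper semicontinuity of `(σ, μ̃)`)** [chunk p0049
L35–L43]: «The invariant `(σ, μ̃) : X = 𝔪-Spec R → (∏_{e ∈ ℤ_{≥0}} ℤ_{≥0}) × (ℝ_{≥0} ∪ {∞})` is upper
semi-continuous with respect to the lexicographical order … That is to say, for any `(α, β)` …, the locus
`X_{≥(α,β)}` is closed (cf. Definition 1.2.1.1)», Def. 1.2.1.1 (p0015 L45): «`f` is upper semi-continuous if the set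
`X_{≥t} := {x ∈ X ; f(x) ≥ t}` is closed for any `t ∈ T`». Setting: as in `KawanoueMatsuki2010_prop_3_1_2_1` (`𝕀`
𝔇-saturated over the coordinate ring, p0049 L31), `d = dim W`. Vendored: for `k` algebraically closed with
`ExpChar k p`, `A` a smooth finitely generated `k`-domain with `ringKrullDim A = d`, `𝕀` 𝔇-saturated over `k`, and ANY
section `𝔫 ↦ (h_𝔫, e_𝔫)` of finite leading generator systems of the `𝕀_𝔫` over the closed points
`𝔫 ∈ MaximalSpectrum A` (on which `μ̃(𝔫)` is read — by Prop. 3.1.2.1 the values do not depend on the section; the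
existence of a section, Part I Prop. 3.1.3.2, is not assumed): for every `t`, the locus
`{𝔫 ; t ≤ (σ(𝔫), μ̃(𝔫))}` is closed in the Zariski topology of `MaximalSpectrum A`, the pair ordered
lexicographically (`Lex (Lex (ℕ → ℤ) × ℝ≥0∞)`). The r.f.g./`Spec R`-extension half of the proposition is not typed.
Statement only; users take `(h : KawanoueMatsuki2010_prop_3_3_1_1)`.
-- TODO(general form): the extension of `(σ, μ̃)` to `Spec R` for `𝕀` of r.f.g. type and its semicontinuity.
[cite: KawanoueMatsuki2010, Prop. 3.3.1.1 with Def. 1.2.1.1, Cor. 1.2.1.3] -/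
def KawanoueMatsuki2010_prop_3_3_1_1 : Prop :=
  ∀ (p : ℕ) (k : Type u) [Field k] [IsAlgClosed k] [ExpChar k p]
    (A : Type u) [CommRing A] [IsDomain A] [Algebra k A] [Algebra.FiniteType k A] [Algebra.Smooth k A]
    (d : ℕ), ringKrullDim A = d →
    ∀ (𝕀 : IdealisticFiltration A), IdealisticFiltration.IsDSaturated k 𝕀 →
    ∀ (N : MaximalSpectrum A → ℕ)
      (h : ∀ 𝔫 : MaximalSpectrum A, Fin (N 𝔫) → Localization.AtPrime 𝔫.asIdeal)
      (e : ∀ 𝔫 : MaximalSpectrum A, Fin (N 𝔫) → ℕ),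
      (∀ 𝔫, IsLGS p (𝕀.atPrime 𝔫.asIdeal) (h 𝔫) (e 𝔫)) →
        ∀ t : Lex (Lex (ℕ → ℤ) × ℝ≥0∞),
          IsClosed {𝔫 : MaximalSpectrum A | t ≤ sigmaMuTildeAt p d 𝕀 𝔫.asIdeal (h 𝔫)}

/-! ## Thm. A.1.1.1 (1): the nonsingularity principle with 𝔇-saturation only -/

/-- NAMED FACT — **Kawanoue–Matsuki 2010, Theorem A.1.1.1 (1) (nonsingularity principle with only 𝔇-saturation and
without ℜ-saturation)** [chunk p0056 L11–L17]: «Let `𝕀` be an idealistic filtration over `R`. Let `P ∈ Spec R ⊂ W`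
be a closed point. (1) Assume that `𝕀` is 𝔇-saturated and that `μ̃(P) = ∞`. Then there exists a regular system of
parameters `(x_1, …, x_N, y_{N+1}, …, y_d)` at `P` such that `ℍ = {(x_l^{p^{e_l}}, p^{e_l})}_{l=1}^N`
`(e_1 ≤ ⋯ ≤ e_N)` is an LGS … of `𝕀_P`, `𝕀_P = G_{R_P}(ℍ)`.» Setting (p0056 L5): as in
`KawanoueMatsuki2010_prop_3_1_2_1`, `d = dim W`. Vendored: for `k` algebraically closed with `ExpChar k p`, `A` a smooth
finitely generated `k`-domain, `𝕀 : IdealisticFiltration A` 𝔇-saturated over `k`, `𝔫 ⊂ A` maximal, and a finite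
leading generator system `(h, e)` of `𝕀_𝔫` with `μ_ℋ(𝕀_𝔫) = ∞` (this is «`μ̃(P) = ∞`» by Def. 3.1.1.1 with Prop.
3.1.2.1): there are a regular system of parameters `x = (x_0, …, x_{d−1})` of `R_P = A_𝔫`
(`Ideal.span (range x) = 𝔪_P`, `𝔪_P.spanFinrank = d` — Matsumura §14, the tree's unbundled convention), `N ≤ d` and
monotone exponents `e' : Fin N → ℕ` such that `l ↦ (x_l^{p^{e'_l}}, e'_l)` is an LGS of `𝕀_𝔫` (`IsLGS p`) and
`𝕀_𝔫 = G({(x_l^{p^{e'_l}}, p^{e'_l}) ; l < N})`. Part (2) of the theorem (an affine neighbourhood `U_P = Spec R_f` on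
which `(x, y)` stays a regular system of parameters, `𝕀_f = G_{R_f}(ℍ)`, `Supp(𝕀) ∩ U_P = V(x_1, …, x_N)` nonsingular,
`(σ(Q), μ̃(Q)) = (σ(P), ∞)` there) is NOT typed. DISCHARGED in this file:
`KawanoueMatsuki2010_thm_A_1_1_1_part1_holds` (via `CenterNonsingularityPrinciple.lean`); users taking
`(h : KawanoueMatsuki2010_thm_A_1_1_1_part1)` are fed `_holds`.
-- TODO(general form): part (2) (the neighbourhood `U_P` and `Supp(𝕀) ∩ U_P = V(x_1, …, x_N)`).
[cite: KawanoueMatsuki2010, Thm. A.1.1.1 (1) with Def. 3.1.1.1, Prop. 3.1.2.1; Matsumura1987, §14 p. 105] -/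
def KawanoueMatsuki2010_thm_A_1_1_1_part1 : Prop :=
  ∀ (p : ℕ) (k : Type u) [Field k] [IsAlgClosed k] [ExpChar k p]
    (A : Type u) [CommRing A] [IsDomain A] [Algebra k A] [Algebra.FiniteType k A] [Algebra.Smooth k A]
    (d : ℕ), ringKrullDim A = d →
    ∀ (𝕀 : IdealisticFiltration A), IdealisticFiltration.IsDSaturated k 𝕀 →
    ∀ (𝔫 : Ideal A) [𝔫.IsMaximal] {ι : Type} [Finite ι] (h : ι → Localization.AtPrime 𝔫) (e : ι → ℕ),
      IsLGS p (𝕀.atPrime 𝔫) h e → muTildeAt 𝕀 𝔫 h = ⊤ →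
        ∃ (x : Fin d → Localization.AtPrime 𝔫) (N : ℕ) (hN : N ≤ d) (e' : Fin N → ℕ),
          Ideal.span (Set.range x) = maximalIdeal (Localization.AtPrime 𝔫) ∧
          (maximalIdeal (Localization.AtPrime 𝔫)).spanFinrank = d ∧
          Monotone e' ∧
          IsLGS p (𝕀.atPrime 𝔫) (fun l : Fin N => x (Fin.castLE hN l) ^ p ^ e' l) e' ∧
          𝕀.atPrime 𝔫 = IdealisticFiltration.generate
            (Set.range fun l : Fin N => (x (Fin.castLE hN l) ^ p ^ e' l, ((p ^ e' l : ℕ) : ℝ)))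

/-! ## Proved edges -/

/-- With the independence fact, `μ̃(P)` is a well-defined number: any two LGS readings agree, so e.g. the hypothesis
«`μ̃(P) = ∞`» of Thm. A.1.1.1 holds on one LGS iff on every LGS. [cite: KawanoueMatsuki2010, Prop. 3.1.2.1, Def. 3.1.1.1] -/
theorem KawanoueMatsuki2010_prop_3_1_2_1.muTildeAt_eq_top_iff (H : KawanoueMatsuki2010_prop_3_1_2_1.{u})
    (p : ℕ) (k : Type u) [Field k] [IsAlgClosed k] [ExpChar k p]
    (A : Type u) [CommRing A] [IsDomain A] [Algebra k A] [Algebra.FiniteType k A] [Algebra.Smooth k A]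
    (𝕀 : IdealisticFiltration A) (hD : IdealisticFiltration.IsDSaturated k 𝕀)
    (𝔫 : Ideal A) [𝔫.IsMaximal] {ι ι' : Type} [Finite ι] [Finite ι']
    {h : ι → Localization.AtPrime 𝔫} {e : ι → ℕ} {h' : ι' → Localization.AtPrime 𝔫} {e' : ι' → ℕ}
    (hH : IsLGS p (𝕀.atPrime 𝔫) h e) (hH' : IsLGS p (𝕀.atPrime 𝔫) h' e') :
    muTildeAt 𝕀 𝔫 h = ⊤ ↔ muTildeAt 𝕀 𝔫 h' = ⊤ := by
  rw [H p k A 𝕀 hD 𝔫 h e h' e' hH hH']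

/-- **Thm. A.1.1.1 (1) gives the 𝔇-saturated generation statement for the SPECIAL LGS it produces**: under the fact,
`𝕀_P` is generated by an LGS all of whose members are `p^e`-th powers of members of one regular system of parameters —
in particular `𝕀_P` is of r.f.g. type (finitely many generators at integral levels).
[cite: KawanoueMatsuki2010, Thm. A.1.1.1 (1); Kawanoue2007, Def. 2.1.1.1 (4)] -/
theorem KawanoueMatsuki2010_thm_A_1_1_1_part1.isRFG (H : KawanoueMatsuki2010_thm_A_1_1_1_part1.{u})
    (p : ℕ) (k : Type u) [Field k] [IsAlgClosed k] [ExpChar k p]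
    (A : Type u) [CommRing A] [IsDomain A] [Algebra k A] [Algebra.FiniteType k A] [Algebra.Smooth k A]
    (d : ℕ) (hd : ringKrullDim A = d)
    (𝕀 : IdealisticFiltration A) (hD : IdealisticFiltration.IsDSaturated k 𝕀)
    (𝔫 : Ideal A) [𝔫.IsMaximal] {ι : Type} [Finite ι] {h : ι → Localization.AtPrime 𝔫} {e : ι → ℕ}
    (hH : IsLGS p (𝕀.atPrime 𝔫) h e) (hμ : muTildeAt 𝕀 𝔫 h = ⊤) :
    (𝕀.atPrime 𝔫).IsRFG := by
  obtain ⟨x, N, hN, e', -, -, -, -, hgen⟩ := H p k A d hd 𝕀 hD 𝔫 h e hH hμ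
  refine ⟨_, Set.finite_range _, ?_, hgen⟩
  rintro _ ⟨l, rfl⟩
  exact ⟨(p ^ e' l : ℕ), by push_cast; rfl⟩

/-- **Prop. 1.2.2.1 (upper semicontinuity of `σ` alone) as a consequence of Prop. 3.3.1.1**: given the fact and
a section of LGS's (so that `(σ, μ̃)` is a function on the closed points), every locus `{𝔫 ; α ≤ σ(𝔫)}` (lexicographic
order on sequences) is closed — because `α ≤ σ(Q) ⟺ (α, 0) ≤ (σ(Q), μ̃(Q))` lexicographically (`μ̃ ≥ 0`). KM prove
1.2.2.1 first and use it inside 3.3.1.1; this edge only records that the typed lexicographic statement contains it.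
[cite: KawanoueMatsuki2010, Prop. 1.2.2.1, Prop. 3.3.1.1] -/
theorem KawanoueMatsuki2010_prop_3_3_1_1.isClosed_le_sigmaAt (H : KawanoueMatsuki2010_prop_3_3_1_1.{u})
    (p : ℕ) (k : Type u) [Field k] [IsAlgClosed k] [ExpChar k p]
    (A : Type u) [CommRing A] [IsDomain A] [Algebra k A] [Algebra.FiniteType k A] [Algebra.Smooth k A]
    (d : ℕ) (hd : ringKrullDim A = d)
    (𝕀 : IdealisticFiltration A) (hD : IdealisticFiltration.IsDSaturated k 𝕀)
    (N : MaximalSpectrum A → ℕ) (h : ∀ 𝔫 : MaximalSpectrum A, Fin (N 𝔫) → Localization.AtPrime 𝔫.asIdeal)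
    (e : ∀ 𝔫 : MaximalSpectrum A, Fin (N 𝔫) → ℕ) (hLGS : ∀ 𝔫, IsLGS p (𝕀.atPrime 𝔫.asIdeal) (h 𝔫) (e 𝔫))
    (α : Lex (ℕ → ℤ)) :
    IsClosed {𝔫 : MaximalSpectrum A | α ≤ toLex (sigmaAt p d 𝕀 𝔫.asIdeal)} := by
  have hc := H p k A d hd 𝕀 hD N h e hLGS (toLex (α, 0))
  convert hc using 1
  ext 𝔫
  simp only [Set.mem_setOf_eq, sigmaMuTildeAt, Prod.Lex.toLex_le_toLex, zero_le, and_true]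
  exact le_iff_lt_or_eq

/-! ## Prop. 3.1.2.1: the named fact, discharged -/

section DischargeF93

/-- **Kawanoue–Matsuki 2010, Proposition 3.1.2.1 — the named fact `KawanoueMatsuki2010_prop_3_1_2_1` DISCHARGED**
[chunk p0043 L3–L5; proof p0043 L7 – p0045 L28]: for `k` algebraically closed with `ExpChar k p`, `A` a smooth finitely
generated `k`-domain, `𝕀` 𝔇-saturated over `A`, `𝔫` maximal and two finite leading generator systems of `𝕀_𝔫`,
`μ̃` read on either agrees. Proof: `muTilde_atPrime_eq_of_isLGS` (`MuTildeIndependence.lean`, the printed argument).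
[cite: KawanoueMatsuki2010, Prop. 3.1.2.1 with §3.1.1] -/
theorem KawanoueMatsuki2010_prop_3_1_2_1_holds : KawanoueMatsuki2010_prop_3_1_2_1.{u} := by
  intro p k _ _ _ A _ _ _ _ _ 𝕀 hD 𝔫 _ ι ι' _ _ h e h' e' H H'
  exact muTilde_atPrime_eq_of_isLGS p k A 𝕀 hD 𝔫 H H'

end DischargeF93

/-! ## Thm. A.1.1.1 (1): the named fact, discharged -/

section DischargeF93c

/-- **Kawanoue–Matsuki 2010, Theorem A.1.1.1 (1) — the named fact `KawanoueMatsuki2010_thm_A_1_1_1_part1`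
DISCHARGED** [chunk p0056 L11–L17; proof A.1.2, chunks p0057 L15 – p0062 L19]: at a closed point of the support of a
𝔇-saturated idealistic filtration with `μ̃(P) = ∞`, some LGS of `𝕀_P` consists of `p^{e_l}`-th powers of part of a
regular system of parameters and generates `𝕀_P`. Proof: `exists_rsop_isLGS_generate` (`CenterNonsingularityPrinciple.lean`,
the printed argument). [cite: KawanoueMatsuki2010, Thm. A.1.1.1 (1)] -/
theorem KawanoueMatsuki2010_thm_A_1_1_1_part1_holds : KawanoueMatsuki2010_thm_A_1_1_1_part1.{u} := by
  intro p k _ _ _ A _ _ _ _ _ d hd 𝕀 hD 𝔫 _ ι _ h e H hμ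
  exact exists_rsop_isLGS_generate p k A d hd 𝕀 hD 𝔫 h e H hμ

end DischargeF93c

end Literature.AlgebraicGeometry.KawanoueMatsuki2010

end
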